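import Mathlib
import Summits.ValiantsHypothesis.ValiantsHypothesis.Theses.ElementaryWordLength
import Summits.ValiantsHypothesis.ValiantsHypothesis.Theorems.ElementaryWordLengthWordPerSuperQuarticPatternGlue
import Summits.ValiantsHypothesis.ValiantsHypothesis.Theorems.ElementaryWordLengthWordPerSuperQuarticPatternConverse

/-!
# Crux `ElementaryWordLength.WordPerSuperQuartic` (stmt-ValiantsHypothesis-6624), line `Sketch`:
# **the open stub is EQUIVALENT to the crux**

Line `Sketch` (idea `signature-noncontainment`; leads c0–c4) reduces the crux — for some `ε > 0` and all
large `n`, every affine elementary word for `E_02(per_n)` has length `≥ n^(4+ε)` — to pattern hardness: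
restrict `per_n` to a set `S` of variable positions at a point `x`, pass to the chain normal form, and ask
for more than `|S|·n^(2+ε)` chain factors (or variable letters).  This file records that BOTH forms of the
line's open stub are equivalent to the crux itself:

* `patternChainHardness_iff_wordPerSuperQuartic` — chain form (the registered stub S1b'
  `stub_patternChainHardness` of `Cruxes/WordPerSuperQuartic/Lines/Sketch.lean`) `↔ WordPerSuperQuartic`;
* `patternBlockHardness_iff_wordPerSuperQuartic` — word form `↔ WordPerSuperQuartic`.

`→`: `Theorems/…PatternGlue.lean` (average over the `n²` cyclic translates of `S`).  `←`:
`Theorems/…PatternConverse.lean` (`S = univ`; a chain of length `m` is a word of length `≤ 25 m`).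
Reading: block/pattern restriction and the chain normal form are a faithful NORMAL FORM of the word model
for `per_n` — they lose nothing and, by themselves, gain nothing; the line is a mirror of the crux, and
any future lower-bound engine for restricted chains plugs into `wordPerSuperQuartic_of_patternChainHardness`.
-/

noncomputable section

-- `Summit.ValiantsHypothesis.ValiantsHypothesis.…` is the tree's mandated single-conjunct layout.
set_option linter.dupNamespace false

namespace Summit.ValiantsHypothesis.ValiantsHypothesis.Theorems.WordPerSuperQuartic

open Literature.Computability.AlgebraicComplexity MvPolynomial

/-- **Pattern chain hardness ⟺ `WordPerSuperQuartic`.**  The registered open stub S1b' of line `Sketch`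
is equivalent to the crux. [folklore] -/
theorem patternChainHardness_iff_wordPerSuperQuartic :
    (∃ ε : ℝ, 0 < ε ∧ ∃ n₀ : ℕ, ∀ n ≥ n₀, ∃ S : Finset (Fin n × Fin n), 0 < S.card ∧
      ∃ x : Fin n × Fin n → ℂ, ∀ L : List ((Fin n × Fin n) × Matrix (Fin 3) (Fin 3) ℂ),
        (∀ e ∈ L, e.1 ∈ S) →
        (∀ e ∈ L, e.2 * e.2 = 0) →
        (L.map (fun e => (1 : Matrix (Fin 3) (Fin 3) (MvPolynomial (Fin n × Fin n) ℂ)) +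
            (MvPolynomial.X e.1 : MvPolynomial (Fin n × Fin n) ℂ) •
              e.2.map (MvPolynomial.C : ℂ → MvPolynomial (Fin n × Fin n) ℂ))).prod =
          Matrix.transvection (0 : Fin 3) 2
            (MvPolynomial.aeval (fun v : Fin n × Fin n =>
                if v ∈ S then MvPolynomial.X v else MvPolynomial.C (x v)) (perPoly (Fin n) ℂ) -
              MvPolynomial.C (MvPolynomial.constantCoeff (MvPolynomial.aeval (fun v : Fin n × Fin n =>
                if v ∈ S then MvPolynomial.X v else MvPolynomial.C (x v)) (perPoly (Fin n) ℂ)))) →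
        (S.card : ℝ) * (n : ℝ) ^ (2 + ε) < (L.length : ℝ)) ↔
    Summit.ValiantsHypothesis.ValiantsHypothesis.Theses.ElementaryWordLength.WordPerSuperQuartic :=
  ⟨wordPerSuperQuartic_of_patternChainHardness, patternChainHardness_of_wordPerSuperQuartic⟩

/-- **Pattern block hardness (word form) ⟺ `WordPerSuperQuartic`.** [folklore] -/
theorem patternBlockHardness_iff_wordPerSuperQuartic :
    (∃ ε : ℝ, 0 < ε ∧ ∃ n₀ : ℕ, ∀ n ≥ n₀, ∃ S : Finset (Fin n × Fin n), 0 < S.card ∧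
      ∃ x : Fin n × Fin n → ℂ, ∀ w : List (Fin 3 × Fin 3 × ℂ × Option (Fin n × Fin n)),
        (∀ l ∈ w, l.1 ≠ l.2.1) →
        (∀ l ∈ w, ∀ v, l.2.2.2 = some v → v ∈ S) →
        (w.map (fun l => Matrix.transvection l.1 l.2.1
            (C l.2.2.1 * l.2.2.2.elim 1 X))).prod =
          Matrix.transvection (0 : Fin 3) 2
            (aeval (fun v : Fin n × Fin n => if v ∈ S then X v else C (x v)) (perPoly (Fin n) ℂ)) →
        (S.card : ℝ) * (n : ℝ) ^ (2 + ε) < (w.countP (fun l => l.2.2.2.isSome) : ℝ)) ↔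
    Summit.ValiantsHypothesis.ValiantsHypothesis.Theses.ElementaryWordLength.WordPerSuperQuartic :=
  ⟨wordPerSuperQuartic_of_patternBlockHardness, fun h =>
    patternBlockHardness_of_patternChainHardness (patternChainHardness_of_wordPerSuperQuartic h)⟩

end Summit.ValiantsHypothesis.ValiantsHypothesis.Theorems.WordPerSuperQuartic

end
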